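import Summits.Ventures.WeilGRH.FlatWindowSpectral
import Summits.Ventures.WeilGRH.FlatTestCentralL
import Literature.NumberTheory.LFunctions.WeilBochnerRepresentationGRH
import Literature.NumberTheory.LFunctions.CharZeroSum
import HarnessLib

/-!
# GRH arm (rh-explicit, venture WeilGRH): under `GRH(χ)` the flat window is asymptotically extremal —
  `2S_χ(a) = −2a·ord_{s=½} L(s, χ) + (log q − K_κ) + O(1/a)`, and `2S_χ(a) → −2Re(L′/L)(½, χ)` when
  `L(½, χ) ≠ 0`

Cell `rh-explicit`, WEIL TRACK (structure seat weil-3, gen9) for the GRH ARM.  The `GRH(χ)` specialisation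
of `FlatWindowSpectral.lean` (the flat-window identity and sandwich for ANY `χ`-window measure): under
`GRH(χ)` the zero-height measure `ν_χ = Σ_ρ m(ρ)δ_{Im ρ}` of `L(s, χ)` represents `Q_χ` on every test
(`WeilBochner.weilQuadraticChar_eq_integral_of_riemannHypothesis`), and

* `integrable_inv_one_add_sq_charZeroHeightMeasure`, `integrable_inv_sq_charZeroHeightMeasure`:
  `(1+t²)⁻¹, t⁻² ∈ L¹(ν_χ)` (unconditional: `Σ_ρ m(ρ)/(1+γ²) < ∞`, `CharZeroSum`, and finitely many
  zeros with `|γ| ≤ 1`);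
* `charZeroHeightMeasure_singleton_zero_of_grh`: **`ν_χ{0} = ord_{s=½} L(s, χ)`** under `GRH(χ)`;
* **`exists_abs_flatSum_add_order_sub_le_of_grh`**: for `χ` primitive mod `q ≠ 1` with `GRH(χ)`,
  `|2Σ_{log n<2a}Λ(n)n^{-1/2}(1 − log n/(2a))Re χ(n) + 2a·ord_{s=½}L(s,χ) − (log q − K_κ)| ≤ C_χ/a`
  for all `a > 0` (`C_χ = 5 + 2Σ_ρ m(ρ)/γ²`);
* **`tendsto_flatSum_div_of_grh`**: `S_χ(a)/a → −ord_{s=½} L(s, χ)` — THE ANALYTIC RANK AT THE CENTRE IS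
  THE SLOPE of the smoothed twisted prime sum below the horizon;
* **`tendsto_flatSum_of_grh`**, **`flatSum_sandwich_of_grh`**: if `L(½, χ) ≠ 0` then
  `2S_χ(a) → −2Re(L′/L)(½, χ)` and, at every window,
  `−2Re(L′/L)(½,χ) + I_κ(a)/a − (2/a)Σ_ρ m(ρ)/γ² ≤ 2S_χ(a) ≤ −2Re(L′/L)(½,χ) + I_κ(a)/a` — the rung
  inequality of `FlatTestCentralL.lean` (right) and the explicit formula (left).

So WEIL3-STRUCTURE §15.2 (vi) («under GRH the flat window is asymptotically extremal; the family /
progression / Chebotarev inequalities are asymptotic equalities for fixed q») is now a theorem, with the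
correction term for a central zero made explicit.  No definitions, no named facts; `GRH(χ)` is a hypothesis.

## References

* A. Weil, *Sur les "formules explicites" de la théorie des nombres premiers* (1952), (11) pp. 261–262.
  [Weil1952FormulesExplicites]
* H. L. Montgomery, R. C. Vaughan, *Multiplicative Number Theory I* (2007), Thm. 10.17 (zero density of
  `L(s, χ)`), (10.35) (the functional equation in logarithmic form). [MontgomeryVaughan2007]
* D. Goldfeld, *Sur les produits partiels eulériens attachés aux courbes elliptiques*, C. R. Acad. Sci.
  Paris 294 (1982) 471–474 (the analytic rank read off smoothed prime sums, the elliptic analogue).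
  [Goldfeld1982CRAS]
-/

set_option autoImplicit false

noncomputable section

open Complex Filter Set MeasureTheory
open scoped Real Topology ComplexConjugate ArithmeticFunction.vonMangoldt

namespace Summit.Ventures.WeilGRH

open Literature.NumberTheory.LFunctions
open Literature.NumberTheory.LFunctions.ExplicitPsiChar
open Literature.NumberTheory.LFunctions.WeilBochner (charZeroHeightMeasure lintegral_charZeroHeightMeasure)

variable {q : ℕ} [NeZero q] {χ : DirichletCharacter ℂ q} {a : ℝ}

/-! ## The zero-height measure: `(1+t²)⁻¹` and `t⁻²` are integrable, and the atom at `0` -/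

/-- `∫ f dν_χ < ∞` for `f ≥ 0` measurable with `Σ_ρ m(ρ) f(Im ρ) < ∞`. -/
theorem integrable_charZeroHeightMeasure_of_summable (χ : DirichletCharacter ℂ q) {f : ℝ → ℝ}
    (hfm : Measurable f) (hf0 : ∀ t, 0 ≤ f t)
    (hsum : Summable fun ρ : charNontrivialZeros χ ↦ (DirichletDisc.zeroOrder χ (ρ : ℂ) : ℝ) * f (ρ : ℂ).im) :
    Integrable f (charZeroHeightMeasure χ) := by
  refine ⟨hfm.aestronglyMeasurable, ?_⟩
  rw [hasFiniteIntegral_iff_ofReal (ae_of_all _ hf0)]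
  rw [lintegral_charZeroHeightMeasure χ hfm.ennreal_ofReal]
  have hterm : ∀ ρ : charNontrivialZeros χ,
      ((DirichletDisc.zeroOrder χ (ρ : ℂ) : ℕ) : ENNReal) * ENNReal.ofReal (f (ρ : ℂ).im) =
        ENNReal.ofReal ((DirichletDisc.zeroOrder χ (ρ : ℂ) : ℝ) * f (ρ : ℂ).im) := fun ρ ↦ by
    rw [ENNReal.ofReal_mul (Nat.cast_nonneg _), ENNReal.ofReal_natCast]
  simp_rw [hterm]
  rw [← ENNReal.ofReal_tsum_of_nonneg (fun ρ ↦ mul_nonneg (Nat.cast_nonneg _) (hf0 _)) hsum]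
  exact ENNReal.ofReal_lt_top

/-- **`(1 + t²)⁻¹ ∈ L¹(ν_χ)`** for `χ` primitive mod `q > 1` (`Σ_ρ m(ρ)/(1+γ²) < ∞`,
`CharZeroSum.summable_zeroOrder_div_one_add_sq`, from `N(T+1,χ) − N(T,χ) ≪ log q(|T|+4)`). -/
theorem integrable_inv_one_add_sq_charZeroHeightMeasure (hprim : χ.IsPrimitive) (hq : 1 < q) :
    Integrable (fun t : ℝ ↦ (1 + t ^ 2)⁻¹) (charZeroHeightMeasure χ) := by
  refine integrable_charZeroHeightMeasure_of_summable χ (by fun_prop) (fun t ↦ by positivity) ?_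
  refine (summable_zeroOrder_div_one_add_sq hprim hq).congr fun ρ ↦ ?_
  rw [div_eq_mul_inv]

/-- **`t⁻² ∈ L¹(ν_χ)`** for `χ` primitive mod `q > 1`: off the finitely many zeros with `|Im ρ| ≤ 1`
(`charZeroFinset`) one has `γ⁻² ≤ 2(1+γ²)⁻¹` (Lean's `0⁻¹ = 0` at a central zero). -/
theorem integrable_inv_sq_charZeroHeightMeasure (hprim : χ.IsPrimitive) (hq : 1 < q) :
    Integrable (fun t : ℝ ↦ (t ^ 2)⁻¹) (charZeroHeightMeasure χ) := by
  have hχ : χ ≠ 1 := by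
    rintro rfl
    rw [DirichletCharacter.isPrimitive_def, DirichletCharacter.conductor_one] at hprim
    omega
  have hmeas : Measurable fun t : ℝ ↦ (t ^ 2)⁻¹ := (measurable_id.pow_const 2).inv
  refine integrable_charZeroHeightMeasure_of_summable χ hmeas (fun t ↦ by positivity) ?_
  have hg := (summable_zeroOrder_div_one_add_sq hprim hq).mul_left 2
  refine Summable.of_norm_bounded_eventually hg ?_
  filter_upwards [(charZeroFinset hχ 1).eventually_cofinite_notMem] with ρ hρ
  rw [mem_charZeroFinset, not_le] at hρ
  have hm0 : (0 : ℝ) ≤ DirichletDisc.zeroOrder χ (ρ : ℂ) := Nat.cast_nonneg _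
  rw [Real.norm_of_nonneg (mul_nonneg hm0 (by positivity))]
  have h1 : 1 < (ρ : ℂ).im ^ 2 := by
    have := sq_lt_sq' (by linarith [abs_nonneg ((ρ : ℂ).im)]) hρ
    simpa [sq_abs] using this
  have h2 : ((ρ : ℂ).im ^ 2)⁻¹ ≤ 2 / (1 + (ρ : ℂ).im ^ 2) := by
    rw [inv_eq_one_div, div_le_div_iff₀ (by positivity) (by positivity)]
    linarith
  calc (DirichletDisc.zeroOrder χ (ρ : ℂ) : ℝ) * ((ρ : ℂ).im ^ 2)⁻¹
      ≤ (DirichletDisc.zeroOrder χ (ρ : ℂ) : ℝ) * (2 / (1 + (ρ : ℂ).im ^ 2)) :=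
        mul_le_mul_of_nonneg_left h2 hm0
    _ = 2 * ((DirichletDisc.zeroOrder χ (ρ : ℂ) : ℝ) / (1 + (ρ : ℂ).im ^ 2)) := by ring

/-- Under `GRH(χ)` a non-trivial zero with `Im ρ = 0` is the central point `½`. -/
theorem eq_one_half_of_grh_of_im_eq_zero (hGRH : χ.RiemannHypothesis) {ρ : ℂ}
    (hρ : ρ ∈ charNontrivialZeros χ) (him : ρ.im = 0) : ρ = 1 / 2 := by
  obtain ⟨hL, h0, h1⟩ := hρ
  have hre : ρ.re = 1 / 2 := hGRH ρ hL h0 h1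
  apply Complex.ext <;> simp [hre, him]

/-- **The atom of `ν_χ` at the centre is the order of vanishing of `L(s, χ)` at `s = ½`** (under
`GRH(χ)`, `χ ≠ 1`): `ν_χ{0} = ord_{s=½} L(s, χ)` (`= 0` iff `L(½, χ) ≠ 0`). -/
theorem charZeroHeightMeasure_singleton_zero_of_grh (hχ : χ ≠ 1) (hGRH : χ.RiemannHypothesis) :
    charZeroHeightMeasure χ {0} = (DirichletDisc.zeroOrder χ (1 / 2) : ENNReal) := by
  classical
  rw [charZeroHeightMeasure, Measure.sum_apply _ (measurableSet_singleton 0)]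
  simp only [Measure.smul_apply, smul_eq_mul]
  by_cases hhalf : (1 / 2 : ℂ) ∈ charNontrivialZeros χ
  · rw [tsum_eq_single ⟨1 / 2, hhalf⟩]
    · simp
    · intro ρ hρ
      have him : (ρ : ℂ).im ≠ 0 := fun h ↦ hρ (Subtype.ext (eq_one_half_of_grh_of_im_eq_zero hGRH ρ.2 h))
      rw [Measure.dirac_apply' _ (measurableSet_singleton 0), indicator_of_notMem (by simpa using him),
        mul_zero]
  · have hzero : DirichletDisc.zeroOrder χ (1 / 2) = 0 := by
      by_contra h
      have hpos : 0 < DirichletDisc.zeroOrder χ (1 / 2) := Nat.pos_of_ne_zero h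
      rw [DirichletDisc.zeroOrder_pos_iff χ hχ] at hpos
      exact hhalf ⟨hpos, by norm_num, by norm_num⟩
    rw [hzero, Nat.cast_zero]
    refine ENNReal.tsum_eq_zero.2 fun ρ ↦ ?_
    have him : (ρ : ℂ).im ≠ 0 := fun h ↦ by
      have := eq_one_half_of_grh_of_im_eq_zero hGRH ρ.2 h
      exact hhalf (this ▸ ρ.2)
    rw [Measure.dirac_apply' _ (measurableSet_singleton 0), indicator_of_notMem (by simpa using him),
      mul_zero]

/-- Real form: `ν_χ.real {0} = ord_{s=½} L(s, χ)` under `GRH(χ)`. -/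
theorem charZeroHeightMeasure_real_singleton_zero_of_grh (hχ : χ ≠ 1) (hGRH : χ.RiemannHypothesis) :
    (charZeroHeightMeasure χ).real {0} = (DirichletDisc.zeroOrder χ (1 / 2) : ℝ) := by
  rw [measureReal_def, charZeroHeightMeasure_singleton_zero_of_grh hχ hGRH, ENNReal.toReal_natCast]

/-! ## Under `GRH(χ)`: the flat-window sum is affine in the window up to `O(1/a)` -/

/-- **`GRH(χ)` ⟹ THE FLAT WINDOW IS ASYMPTOTICALLY EXTREMAL, WITH THE CENTRAL ZERO AS THE SLOPE.**
For `χ` primitive mod `q ≠ 1` with `GRH(χ)` there is `C` such that for every window `a > 0`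

  `|2Σ_{log n<2a} Λ(n)n^{-1/2}(1 − log n/(2a))Re χ(n) + 2a·ord_{s=½}L(s,χ) − (log q − K_κ)| ≤ C/a`

(`K_κ = log 4π + γ + 2∫₀^∞(e^{(1/2−κ)t} − 1)dt/(2 sinh t) = log 8π + γ ± π/2`).  The one-window
inequalities `2S_χ(a) + K_κ − I_κ(a)/a ≤ log q` of `TwistedFlatTest.lean` are therefore asymptotic
EQUALITIES iff `L(½, χ) ≠ 0`, and in general the smoothed twisted prime sum below `e^{2a}` falls
linearly at the rate of the analytic rank at the centre. -/
theorem exists_abs_flatSum_add_order_sub_le_of_grh (hq : q ≠ 1) (hprim : χ.IsPrimitive)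
    (hGRH : χ.RiemannHypothesis) :
    ∃ C : ℝ, ∀ a : ℝ, 0 < a →
      |2 * (∑ n ∈ weilPrimeIndex a,
            (Λ n : ℝ) / Real.sqrt n * ((1 - Real.log n / (2 * a)) * (χ (n : ZMod q)).re)) +
          2 * a * (DirichletDisc.zeroOrder χ (1 / 2) : ℝ) -
          (Real.log q - (Real.log (4 * π) + Real.eulerMascheroniConstant +
            2 * ∫ t in Ioi (0 : ℝ), weilKillingDensityPar (charParity χ) t))| ≤ C / a := by
  have hq1 : 1 < q := lt_of_le_of_ne NeZero.one_le (Ne.symm hq)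
  have hχ : χ ≠ 1 := by
    rintro rfl
    rw [DirichletCharacter.isPrimitive_def, DirichletCharacter.conductor_one] at hprim
    exact hq hprim.symm
  refine ⟨5 + 2 * ∫ t, (t ^ 2)⁻¹ ∂charZeroHeightMeasure χ, fun a ha ↦ ?_⟩
  rw [← charZeroHeightMeasure_real_singleton_zero_of_grh hχ hGRH]
  exact abs_flatSum_add_atom_sub_le hq χ ha
    (fun g hg _ ↦ WeilBochner.weilQuadraticChar_eq_integral_of_riemannHypothesis hq hprim hGRH hg)
    (integrable_inv_one_add_sq_charZeroHeightMeasure hprim hq1)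
    (integrable_inv_sq_charZeroHeightMeasure hprim hq1)

/-- **`GRH(χ)` ⟹ the analytic rank at the centre is the slope of the flat-window sum**:
`(1/a)Σ_{log n<2a} Λ(n)n^{-1/2}(1 − log n/(2a))Re χ(n) → −ord_{s=½} L(s, χ)` (`a → ∞`). -/
theorem tendsto_flatSum_div_of_grh (hq : q ≠ 1) (hprim : χ.IsPrimitive) (hGRH : χ.RiemannHypothesis) :
    Tendsto (fun a : ℝ ↦ (∑ n ∈ weilPrimeIndex a,
          (Λ n : ℝ) / Real.sqrt n * ((1 - Real.log n / (2 * a)) * (χ (n : ZMod q)).re)) / a) atTop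
      (𝓝 (-(DirichletDisc.zeroOrder χ (1 / 2) : ℝ))) := by
  have hq1 : 1 < q := lt_of_le_of_ne NeZero.one_le (Ne.symm hq)
  have hχ : χ ≠ 1 := by
    rintro rfl
    rw [DirichletCharacter.isPrimitive_def, DirichletCharacter.conductor_one] at hprim
    exact hq hprim.symm
  rw [← charZeroHeightMeasure_real_singleton_zero_of_grh hχ hGRH]
  exact tendsto_flatSum_div hq χ
    (fun g hg ↦ WeilBochner.weilQuadraticChar_eq_integral_of_riemannHypothesis hq hprim hGRH hg)
    (integrable_inv_one_add_sq_charZeroHeightMeasure hprim hq1)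
    (integrable_inv_sq_charZeroHeightMeasure hprim hq1)

/-- **`GRH(χ)` and `L(½, χ) ≠ 0` ⟹ `2S_χ(a) → −2 Re (L′/L)(½, χ)`** (`a → ∞`): the flat-window
inequality `2S_χ(a) ≤ −2Re(L′/L)(½,χ) + I_κ(a)/a` of `FlatTestCentralL.lean` is an asymptotic equality —
the smoothed twisted prime sum below the horizon converges to the CENTRAL VALUE of `−2Re L′/L`. -/
theorem tendsto_flatSum_of_grh (hq : q ≠ 1) (hprim : χ.IsPrimitive) (hGRH : χ.RiemannHypothesis)
    (hL : χ.LFunction (1 / 2) ≠ 0) :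
    Tendsto (fun a : ℝ ↦ 2 * (∑ n ∈ weilPrimeIndex a,
          (Λ n : ℝ) / Real.sqrt n * ((1 - Real.log n / (2 * a)) * (χ (n : ZMod q)).re))) atTop
      (𝓝 (-2 * (logDeriv χ.LFunction (1 / 2)).re)) := by
  have hq1 : 1 < q := lt_of_le_of_ne NeZero.one_le (Ne.symm hq)
  have hχ : χ ≠ 1 := by
    rintro rfl
    rw [DirichletCharacter.isPrimitive_def, DirichletCharacter.conductor_one] at hprim
    exact hq hprim.symm
  rw [neg_two_mul_re_logDeriv_LFunction_one_half hprim hχ hL]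
  have h0 : charZeroHeightMeasure χ {0} = 0 := by
    rw [charZeroHeightMeasure_singleton_zero_of_grh hχ hGRH]
    have : DirichletDisc.zeroOrder χ (1 / 2) = 0 := by
      by_contra h
      exact hL ((DirichletDisc.zeroOrder_pos_iff χ hχ _).1 (Nat.pos_of_ne_zero h))
    rw [this, Nat.cast_zero]
  exact tendsto_flatSum_of_measure_zero hq χ
    (fun g hg ↦ WeilBochner.weilQuadraticChar_eq_integral_of_riemannHypothesis hq hprim hGRH hg)
    (integrable_inv_one_add_sq_charZeroHeightMeasure hprim hq1)
    (integrable_inv_sq_charZeroHeightMeasure hprim hq1) h0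

/-- **Two-sided, for every window, under `GRH(χ)` with `L(½, χ) ≠ 0`**:
`−2Re(L′/L)(½,χ) + I_κ(a)/a − C_χ/a ≤ 2S_χ(a) ≤ −2Re(L′/L)(½,χ) + I_κ(a)/a` with
`C_χ = 2Σ_ρ m(ρ)/γ²` — the upper bound is the rung (`flatSum_le_neg_two_re_logDeriv_LFunction`), the
lower bound is the explicit formula. -/
theorem flatSum_sandwich_of_grh (hq : q ≠ 1) (hprim : χ.IsPrimitive) (hGRH : χ.RiemannHypothesis)
    (hL : χ.LFunction (1 / 2) ≠ 0) (ha : 0 < a) :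
    -2 * (logDeriv χ.LFunction (1 / 2)).re +
          1 / a * (∫ t in Ioi (0 : ℝ), weilArchDensityPar (charParity χ) t * min t (2 * a)) -
          2 / a * ∫ t, (t ^ 2)⁻¹ ∂charZeroHeightMeasure χ ≤
        2 * (∑ n ∈ weilPrimeIndex a,
          (Λ n : ℝ) / Real.sqrt n * ((1 - Real.log n / (2 * a)) * (χ (n : ZMod q)).re)) ∧
      2 * (∑ n ∈ weilPrimeIndex a,
          (Λ n : ℝ) / Real.sqrt n * ((1 - Real.log n / (2 * a)) * (χ (n : ZMod q)).re)) ≤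
        -2 * (logDeriv χ.LFunction (1 / 2)).re +
          1 / a * (∫ t in Ioi (0 : ℝ), weilArchDensityPar (charParity χ) t * min t (2 * a)) := by
  have hq1 : 1 < q := lt_of_le_of_ne NeZero.one_le (Ne.symm hq)
  have hχ : χ ≠ 1 := by
    rintro rfl
    rw [DirichletCharacter.isPrimitive_def, DirichletCharacter.conductor_one] at hprim
    exact hq hprim.symm
  have hm : (charZeroHeightMeasure χ).real {0} = 0 := by
    rw [charZeroHeightMeasure_real_singleton_zero_of_grh hχ hGRH]
    have : DirichletDisc.zeroOrder χ (1 / 2) = 0 := by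
      by_contra h
      exact hL ((DirichletDisc.zeroOrder_pos_iff χ hχ _).1 (Nat.pos_of_ne_zero h))
    rw [this, Nat.cast_zero]
  obtain ⟨hlo, hhi⟩ := flatWindow_sandwich hq χ ha
    (fun g hg _ ↦ WeilBochner.weilQuadraticChar_eq_integral_of_riemannHypothesis hq hprim hGRH hg)
    (integrable_inv_one_add_sq_charZeroHeightMeasure hprim hq1)
    (integrable_inv_sq_charZeroHeightMeasure hprim hq1)
  rw [neg_two_mul_re_logDeriv_LFunction_one_half hprim hχ hL]
  rw [hm] at hlo hhi
  constructor <;> linarith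

end Summit.Ventures.WeilGRH

end
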